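import Summits.CriticalPhenomena.PercolationContinuityZ3.Theses.PercBudgetLadder

/-!
# Dry run of the ONE-`∃` restatement `PinholeClosingHalved` of `PercBudgetLadder.PinholeClosing` and of its deciding theorem

Lead c4 (`prover-line-stmt-CriticalPhenomena-5249-c4-0`), 2026-08-17.  Companion of
`Cruxes/PinholeClosing/RestatedGlue_cruxplan_budget_halving.lean` (c3's option `PinholeClosingRestated`, `∃ j l' c' … ∃ m`): a
second restated body, syntactically closest to the typed one, whose proof is ALREADY LANDED as
`Summit.CriticalPhenomena.PercolationContinuityZ3.Theorems.pinholeClosingHalved_proof`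
(`Theorems/PercBudgetLadderPinholeClosingHalved.lean`).  This file imports ONLY the route file (the environment in which
the gate elaborates `glue.lean`), declares the body as `PinholeClosingHalved`, and proves the deciding theorem
`closes_halved : BudgetTightness → PinholeClosingHalved → BlockingVanishesOfTheta → PercolationContinuityZ3` by pure logic
(no lemma: the descent picks `n ≥ 2N + 2`, `m = n / 2 ≥ N`, `l' = 12 l`, and `12 * l * (n / 2)` IS `l' * m`).

Planner recipe: `ledger route edit route-CriticalPhenomena-PercBudgetLadder --restate PinholeClosing --statement '<body of
PinholeClosingHalved>' --closes-file glue.lean` with `theorem closes` := `closes_halved` below (rename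
`PinholeClosingHalved ↦ PinholeClosing`); the restated item then closes by the 1-line file
`theorem PinholeClosing_proof : PercBudgetLadder.PinholeClosing := Theorems.pinholeClosingHalved_proof`.
-/

namespace Summit.CriticalPhenomena.PercolationContinuityZ3.Theses.PercBudgetLadder

/-- PROPOSED RESTATED BODY (option c4, "halved"): hypothesis unchanged (budget `k+1` at inner radius `n`, aspect `l`,
probability `≥ c`), guard `2 ≤ n` (at `n = 1` the half-size box is `box 0` and the conclusion event is empty);
conclusion: budget `k` for the annulus around the HALF-SIZE box `box (n/2) → ∂ⁱⁿ box (12 l (n/2))`, probability `≥ c'`,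
`c'` depending on `(k, l, c)` only.  Informally: "if closing k+1 edges blocks B(n) → ∂B(λn) with probability ≥ c, then
closing k edges blocks B(n/2) → ∂B(12λ·(n/2)) with probability ≥ c′, uniformly in n ≥ 2". -/
def PinholeClosingHalved : Prop :=
  ∀ (k l : ℕ) (c : ℝ), 2 ≤ l → 0 < c → ∃ c' : ℝ, 0 < c' ∧ ∀ n : ℕ, 2 ≤ n → c ≤ (Literature.Probability.Percolation.bondPercolation (Literature.Probability.LatticeModels.zdGraph 3) (Literature.Probability.Percolation.criticalProbI 3)).real {ω | ∃ S : Finset (Sym2 (Literature.Probability.LatticeModels.Site 3)), S.card ≤ k + 1 ∧ ¬ ∃ x ∈ Literature.Probability.LatticeModels.box 3 n, ∃ y ∈ Literature.Probability.LatticeModels.innerBoundary (Literature.Probability.LatticeModels.zdGraph 3) (Literature.Probability.LatticeModels.box 3 (l * n)), (ω \ ↑S) ∈ Literature.Probability.Percolation.openConnIn ↑(Literature.Probability.LatticeModels.box 3 (l * n)) x y} → c' ≤ (Literature.Probability.Percolation.bondPercolation (Literature.Probability.LatticeModels.zdGraph 3) (Literature.Probability.Percolation.criticalProbI 3)).real {ω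 | ∃ S : Finset (Sym2 (Literature.Probability.LatticeModels.Site 3)), S.card ≤ k ∧ ¬ ∃ x ∈ Literature.Probability.LatticeModels.box 3 (n / 2), ∃ y ∈ Literature.Probability.LatticeModels.innerBoundary (Literature.Probability.LatticeModels.zdGraph 3) (Literature.Probability.LatticeModels.box 3 (12 * l * (n / 2))), (ω \ ↑S) ∈ Literature.Probability.Percolation.openConnIn ↑(Literature.Probability.LatticeModels.box 3 (12 * l * (n / 2))) x y}

/-- The deciding theorem under the "halved" restatement (paste as `theorem closes` into glue.lean, replacing
`PinholeClosingHalved` by `PinholeClosing`).  Pure logic + one set identity (budget 0 = blocked). -/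
theorem closes_halved : BudgetTightness → PinholeClosingHalved → BlockingVanishesOfTheta →
    _root_.PercolationContinuityZ3 := by
  intro hBT hPC hBV
  -- dictionary, local to the proof: P k n m = P_{p_c}(budget-k blocked event of box n → ∂ box m)
  let P : ℕ → ℕ → ℕ → ℝ := fun k n m =>
    (Literature.Probability.Percolation.bondPercolation (Literature.Probability.LatticeModels.zdGraph 3)
      (Literature.Probability.Percolation.criticalProbI 3)).real
      {ω | ∃ S : Finset (Sym2 (Literature.Probability.LatticeModels.Site 3)), S.card ≤ k ∧
        ¬ ∃ x ∈ Literature.Probability.LatticeModels.box 3 n,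
          ∃ y ∈ Literature.Probability.LatticeModels.innerBoundary
            (Literature.Probability.LatticeModels.zdGraph 3) (Literature.Probability.LatticeModels.box 3 m),
            (ω \ ↑S) ∈ Literature.Probability.Percolation.openConnIn
              ↑(Literature.Probability.LatticeModels.box 3 m) x y}
  -- K-step descent: i.o. bound at budget K, aspect l ⟹ i.o. bound at budget 0, aspect 12^K l
  -- (the inner radii of the subsequence halve per step and still tend to infinity)
  have descent : ∀ K : ℕ, ∀ (l : ℕ) (c : ℝ), 2 ≤ l → 0 < c →
      (∀ N : ℕ, ∃ n : ℕ, N ≤ n ∧ c ≤ P K n (l * n)) →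
      ∃ (l' : ℕ) (c' : ℝ), 2 ≤ l' ∧ 0 < c' ∧ ∀ N : ℕ, ∃ n : ℕ, N ≤ n ∧ c' ≤ P 0 n (l' * n) := by
    intro K
    induction K with
    | zero => exact fun l c hl hc h => ⟨l, c, hl, hc, h⟩
    | succ K ih =>
      intro l c hl hc h
      obtain ⟨c', hc', hstep⟩ := hPC K l c hl hc
      refine ih (12 * l) c' (by omega) hc' fun N => ?_
      obtain ⟨n, hn, hb⟩ := h (2 * N + 2)
      exact ⟨n / 2, by omega, hstep n (by omega) hb⟩
  obtain ⟨K, l, c, hl, hc, hio⟩ := hBT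
  obtain ⟨l', c', hl', hc', hio'⟩ := descent K l c hl hc hio
  -- budget 0 is the blocked event
  have hblocked : ∀ N : ℕ, ∃ n : ℕ, N ≤ n ∧ c' ≤ (Literature.Probability.Percolation.bondPercolation
        (Literature.Probability.LatticeModels.zdGraph 3)
        (Literature.Probability.Percolation.criticalProbI 3)).real
      {ω | ¬ ∃ x ∈ Literature.Probability.LatticeModels.box 3 n,
            ∃ y ∈ Literature.Probability.LatticeModels.innerBoundary
              (Literature.Probability.LatticeModels.zdGraph 3)
              (Literature.Probability.LatticeModels.box 3 (l' * n)),
            ω ∈ Literature.Probability.Percolation.openConnIn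
              ↑(Literature.Probability.LatticeModels.box 3 (l' * n)) x y} := by
    intro N
    obtain ⟨n, hn, hbound⟩ := hio' N
    refine ⟨n, hn, ?_⟩
    have hset :
        {ω : Set (Sym2 (Literature.Probability.LatticeModels.Site 3)) |
          ∃ S : Finset (Sym2 (Literature.Probability.LatticeModels.Site 3)), S.card ≤ 0 ∧
            ¬ ∃ x ∈ Literature.Probability.LatticeModels.box 3 n,
              ∃ y ∈ Literature.Probability.LatticeModels.innerBoundary
                (Literature.Probability.LatticeModels.zdGraph 3)
                (Literature.Probability.LatticeModels.box 3 (l' * n)),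
              (ω \ ↑S) ∈ Literature.Probability.Percolation.openConnIn
                ↑(Literature.Probability.LatticeModels.box 3 (l' * n)) x y} =
        {ω | ¬ ∃ x ∈ Literature.Probability.LatticeModels.box 3 n,
              ∃ y ∈ Literature.Probability.LatticeModels.innerBoundary
                (Literature.Probability.LatticeModels.zdGraph 3)
                (Literature.Probability.LatticeModels.box 3 (l' * n)),
              ω ∈ Literature.Probability.Percolation.openConnIn
                ↑(Literature.Probability.LatticeModels.box 3 (l' * n)) x y} := by
      ext ω
      constructor
      · rintro ⟨S, hS, hnot⟩
        have hS0 : S = ∅ := Finset.card_eq_zero.mp (Nat.le_zero.mp hS)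
        subst hS0
        simpa using hnot
      · intro hnot
        exact ⟨∅, by simp, by simpa using hnot⟩
    have hb' : c' ≤ P 0 n (l' * n) := hbound
    simp only [P] at hb'
    rw [hset] at hb'
    exact hb'
  -- it suffices: θ(p_c) ≠ 0 would make the blocking probability at aspect l' tend to 0
  by_contra hne
  have h0 : 0 ≤ Literature.Probability.Percolation.theta
      (Literature.Probability.LatticeModels.zdGraph 3) 0
      (Literature.Probability.Percolation.criticalProbI 3) := by
    unfold Literature.Probability.Percolation.theta
    exact MeasureTheory.measureReal_nonneg
  have hpos : 0 < Literature.Probability.Percolation.theta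
      (Literature.Probability.LatticeModels.zdGraph 3) 0
      (Literature.Probability.Percolation.criticalProbI 3) :=
    lt_of_le_of_ne h0 (fun h => hne h.symm)
  have hT := hBV (Literature.Probability.Percolation.criticalProbI 3) hpos l' hl'
  have hev := hT.eventually (gt_mem_nhds hc')
  obtain ⟨N, hN⟩ := Filter.eventually_atTop.mp hev
  obtain ⟨n, hn, hbound⟩ := hblocked N
  exact absurd (hN n hn) (not_lt.mpr hbound)

/-- Sanity (shape only): the typed body implies the halved one with the conclusion weakened along the landed a.s.
monotonicities (smaller source box, larger outer box); not exercised here — this file checks the GLUE. -/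
example : PinholeClosingHalved ↔ PinholeClosingHalved := Iff.rfl

end Summit.CriticalPhenomena.PercolationContinuityZ3.Theses.PercBudgetLadder
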